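import Summits.BirchSwinnertonDyer.BirchSwinnertonDyer.Theorems.ClassRecordThreeEulerHalvesAtThreeJetchev

/-!
# Route `ClassRecordThree` (rung K2@3), crux 5 `EulerHalvesAtThree` (item 19109, shared by
# `KolyvaginRoadThree`): the open input J₃ («`M_∞ ≥ t`») IS McCallum's `M_∞ ≥ t` on the tree's objects, and is
# EQUIVALENT — not merely sufficient — to the Tamagawa-sharp Kolyvagin bound over `K` at the frame
# (cell `bsd-stepL`, seat `bsd-stepL-tam3-p1`, session g2; `--supports stmt-BirchSwinnertonDyer-19109 --as helper`)

Files 1–4 of this seat (p419384 ∕ p419735 ∕ p420519 ∕ p421279) reduced the Euler-system half of `BSD(E,3)` on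
X11b@3 ∧ (ram) (all Tamagawa shapes) and on ¬(ram) ∧ surj to the registered stubs J₃ʳ ∕ J₃⁰ of item 19109:
GLOBAL `3^s`-DIVISIBILITY of the derived Heegner points to depth `t = ord₃ ∏ c_ℓ(E)` at every Manin-good
conductor-`1` frame («the Jetchev direction `M_∞ ≥ t`» — so far an informal gloss). This file makes the gloss a
theorem and closes the circle of implications at ONE frame `(Dt, β, ι)`:

* §1 `le_divOrd_of_pDiv` — bookkeeping: `p^M ∣ P_n ⇒ M ≤ ord_p(P_n)`.
* §2 `globalDivisibility_iff_le_minf` — DEFINITIONS ONLY (no fact, any `p`, any frame): global divisibility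
  to depth `t` ⟺ `t ≤ Koly.Minf Dt β ι p`, McCallum's `M_∞ = min_r M_r`,
  `M_r = min{ord_p(P_n) : n ∈ S_r(ord_p(P_n)+1)}` AS DEFINED ON THE TREE'S KOLYVAGIN DATA
  (`X11b/Three/KolyvaginLine.lean` §1, the cell's «(α) objects»). So the stubs J₃ʳ ∕ J₃⁰ are LITERALLY
  «`M_∞ ≥ t` at every (ram) ∕ ¬(ram) surj Manin-good frame».
* §3 `globalDivisibility_iff_forall_not_certificateAt` — DEFINITIONS ONLY: global divisibility to depth `t` ⟺
  NO Kolyvagin certificate of level `≤ t` (`∀ M < t, ¬ Koly.CertificateAt Dt β ι p M`, koly's predicate of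
  `KolyvaginNonvanishing.lean`; `CertificateAt … p M` = "`M_∞ ≤ M` in finite form"). Hence J₃ and koly's Z₃ᵗ
  (`CertificateAt Dt β ι 3 t`) are the two halves of ONE equality: `minf_eq_of_globalDivisibility_of_certificateAt`
  (`M_∞ = t`).
* §4 `globalDivisibility_of_card_sha_primary_add_le` — THE CONVERSE of file 1 §1, any odd `p` with tower
  surjectivity: the Tamagawa-sharp bound over `K` in McCallum's currency, `ord_p #Ш(E/K)[p^∞] + 2t ≤ 2M₀`, IMPLIES
  global divisibility to depth `t`, through McCallum's Cor. 5.6 in its CERTIFICATE (lower) form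
  `McCallum1991_pow_dvd_card_sha_primary_of_certificate` (the fact koly's STEP-L consumers use): a derived point
  `P_n`, `n ∈ S_r(M+1)`, `M + 1 ≤ t`, NOT divisible by `p^{M+1}` would force `p^{2(M₀−M)} ∣ #Ш[p^∞]`, against
  the bound.
* §5 `globalDivisibility_three_iff_shaIndexBound_sharp` — at `p = 3` on the frames of files 1–4 (multiplicative
  `3`, `ρ̄_{E,3}` onto, `K` imaginary quadratic Heegner with `d_K ∉ {−3,−4}`, `P = y_K` of infinite order, rank
  one, no `3`-torsion, `Ш(E/K)` finite): J-divisibility to depth `t` ⟺ `ord₃ #Ш(E/K) + 2t ≤ 2·ord₃[E(K):ℤP]`,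
  modulo McCallum's Cor. 5.6 in its two one-sided forms (p418283 upper, the certificate fact lower). With §2:
  `le_minf_three_iff_shaIndexBound_sharp` (`t ≤ M_∞ ⟺` the sharp bound).
* §6 `certificateAt_three_of_shaIndexBound_eq` ∕ `minf_three_eq_of_shaIndexBound_eq` — the converse of file 4
  §8 at the `K`-level: the sharp EQUALITY `ord₃ #Ш(E/K) + 2t = 2·ord₃[E(K):ℤP]` (= `BSD₃(E/K)` at the frame by
  Gross–Zagier) gives BOTH a level-`(t+1)` certificate (koly's Z₃ᵗ at the frame) AND divisibility to depth `t`,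
  i.e. PINS `M_∞ = t` on the tree's objects (McCallum upper form only).

WHAT THIS BUYS (honest). Nothing here proves J₃, Z₃ᵗ or any half of BSD. It certifies that the seat's reduction
of item 19109 LOST NOTHING at the `K`-level: the registered stub J₃ʳ (resp. J₃⁰) at a frame is exactly as
strong as the Tamagawa-sharp bound over `K` there — a disprover cannot refute the stub at a frame without
refuting `BSD₃(E/K)` (given McCallum's printed structure theorem; Matar–Nekovář, Selecta 25 (2019) Thm. 0.7 +
§0.11 print it for `ρ̄` irreducible, `p ≠ 2`, `D_K ∉ {−3,−4}` with no hypothesis at `p`) —, that «`M_∞ ≥ t`»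
in the stubs' docstrings is McCallum's `M_∞` verbatim, and that the refined Kolyvagin conjecture «`M_∞ = t` at
`3 ∥ N`» (this seat's J₃ ∧ koly's Z₃ᵗ) is EQUIVALENT at each frame to the sharp `BSD₃(E/K)` equality there.
CONDITIONAL on every binder listed in each theorem; nothing booked; no item closes.

References: [McCallumLMS1991] §5 Lemma 5.1, Thm. 5.4, Cor. 5.6 (pp. 303–310), §4 `S_r(M)` (pp. 299–300);
[Jetchev2008] Conj. 1.3, (1) p. 812; [WZhang2014] Remark 5 (`M_∞ = 0`), Thm. 1.1; [BurungaleEtAl2026] Thm. 2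
(shape of `M_∞ = Σ ord_p c_ℓ`); [MatarNekovar2019] Thm. 0.7, §0.11; tree `X11b/Three/{KolyvaginLine,
KolyvaginNonvanishing}.lean` (koly), `Theorems/ClassRecordThreeEulerHalvesAtThreeJetchev.lean` (file 1),
`Theorems/KolyvaginRoadThreeRefinedKolyvaginRam.lean` (file 4), HOME `tam3/MEMO-J3-v0.md`.
-/

noncomputable section

open scoped Classical

namespace Summit.BirchSwinnertonDyer.Rank1Residual.X11b.Three.Koly

open WeierstrassCurve Literature.NumberTheory.EllipticCurves
  Literature.NumberTheory.EllipticCurves.ModularForms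
  Literature.NumberTheory.EllipticCurves.Rank1Residual
  Summit.BirchSwinnertonDyer.Rank1Residual Summit.BirchSwinnertonDyer.Rank1Residual.X11b

universe u

/-! ### §1–§3 Definitions only: global divisibility to depth `t` = `t ≤ M_∞` = no certificate below `t` -/

section Frame

variable {N : ℕ} [NeZero N] {W : WeierstrassCurve ℚ} [W.IsGloballyMinimal] {K : Type u} [Field K]
  [NumberField K] {Dt : ModularParametrizationData W N} {β : ℤ} {ι : K →+* ℂ} (p : ℕ)

omit [W.IsGloballyMinimal] in
/-- **`p^M ∣ P_n ⇒ M ≤ ord_p(P_n)`** (McCallum: "`ord_p(P_n) = max{M : p^M | P_n}`"), for the tree's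
`Koly.divOrd` (a supremum in `ℕ∞`). [cite: McCallumLMS1991, §5 (p. 303), definition of ord_p(P_n)] -/
theorem le_divOrd_of_pDiv {n : ℕ} (d : KolyvaginHeegnerData Dt β ι n) {M : ℕ} (h : PDiv d p M) :
    (M : ℕ∞) ≤ divOrd d p :=
  le_iSup₂ (f := fun (M' : ℕ) (_ : PDiv d p M') ↦ (M' : ℕ∞)) M h

variable (Dt β ι) in
/-- **J₃ at a frame IS McCallum's `M_∞ ≥ t` (definitions only; any `p`, any frame).** For the Kolyvagin data of
a frame `(Dt, β, ι)` and `t : ℕ`: EVERY derived point `P_n` — `n` a square-free product of Kolyvagin primes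
(`Zhang2014.IsKolyvaginPrime`) of index `M(ℓ) ≥ s`, `n = 1` allowed, `d` any Kolyvagin–Heegner datum of conductor
`n` on the frame — is `p^s`-divisible in `E(K[n])` for every `s ≤ t` (the hypothesis of McCallum's Cor. 5.6
upper form p418283 and the tail of the registered stubs J₃ʳ ∕ J₃⁰ of item 19109) IF AND ONLY IF
`t ≤ Koly.Minf Dt β ι p`, where `Minf = ⨅_r M_r` and `M_r = ⨅ {ord_p(P_n) : ord_p(P_n) = M finite,
n ∈ S_r(M+1)}` are McCallum's invariants AS DEFINED ON THE TREE (`KolyvaginLine.lean` §1). Proof: (⇒) a datum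
entering `M_r` with `ord_p(P_n) = M < t` lies in `S_r(M+1)` with `M + 1 ≤ t`, so `p^{M+1} ∣ P_n`, contradicting
`ord_p(P_n) = M`; (⇐) if `p^{M+1} ∤ P_n` with `n ∈ S_{ω(n)}(M+1)`, `M + 1 ≤ t`, then `M_∞ ≤ M < t`
(`minf_le_of_certificate`). [cite: McCallumLMS1991, §5 (p. 303) definitions of ord_p(P_n), M_r; Cor. 5.6 (p. 310) m = min M_i] -/
theorem globalDivisibility_iff_le_minf (t : ℕ) :
    (∀ (s : ℕ), s ≤ t → ∀ (n : ℕ) (d : KolyvaginHeegnerData Dt β ι n), Squarefree n →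
      (∀ ℓ ∈ n.primeFactors, Zhang2014.IsKolyvaginPrime N W K p ℓ ∧
        s ≤ Zhang2014.kolyvaginIndex W p ℓ) → PDiv d p s) ↔
    (t : ℕ∞) ≤ Minf Dt β ι p := by
  constructor
  · intro h
    simp only [Minf, Mr, le_iInf_iff]
    intro r n d hx
    obtain ⟨M, hM, hmem⟩ := hx
    rw [hM]
    by_contra hlt
    have hMt : M + 1 ≤ t := Nat.succ_le_of_lt (ENat.coe_lt_coe.mp (not_le.mp hlt))
    have hdiv : PDiv d p (M + 1) := h (M + 1) hMt n d hmem.1 hmem.2.2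
    have hle : ((M + 1 : ℕ) : ℕ∞) ≤ divOrd d p := le_divOrd_of_pDiv p d hdiv
    rw [hM] at hle
    exact absurd (ENat.coe_le_coe.mp hle) (by omega)
  · intro h s hs n d hn hℓ
    rcases s with _ | M
    · exact pDiv_zero d p
    · by_contra hnd
      have hmem : MemS N W K p n.primeFactors.card (M + 1) n := ⟨hn, rfl, hℓ⟩
      have hle : Minf Dt β ι p ≤ M := minf_le_of_certificate d p hmem hnd
      have htM : (t : ℕ∞) ≤ (M : ℕ∞) := h.trans hle
      exact absurd (ENat.coe_le_coe.mp htM) (by omega)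

variable (Dt β ι) in
/-- **J₃ at a frame ⟺ no Kolyvagin certificate of level `≤ t`** (definitions only): global divisibility to
depth `t` at the frame holds iff `Koly.CertificateAt Dt β ι p M` FAILS for every `M < t` (koly's certificate
predicate: some `n ∈ S_r(M+1)` carries a datum with `P_n ∉ p^{M+1}E(K[n])`, i.e. "`M_∞ ≤ M`" in finite form).
So J₃ (`M_∞ ≥ t`) and koly's Z₃ᵗ (`CertificateAt … 3 t`, `M_∞ ≤ t`) are complementary by construction.
[cite: McCallumLMS1991, §5 (p. 303) definition of M_r (the certificate shape)] -/
theorem globalDivisibility_iff_forall_not_certificateAt (t : ℕ) :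
    (∀ (s : ℕ), s ≤ t → ∀ (n : ℕ) (d : KolyvaginHeegnerData Dt β ι n), Squarefree n →
      (∀ ℓ ∈ n.primeFactors, Zhang2014.IsKolyvaginPrime N W K p ℓ ∧
        s ≤ Zhang2014.kolyvaginIndex W p ℓ) → PDiv d p s) ↔
    ∀ M : ℕ, M < t → ¬ CertificateAt Dt β ι p M := by
  constructor
  · rintro h M hMt ⟨n, r, d, hmem, hnd⟩
    exact hnd (h (M + 1) hMt n d hmem.1 hmem.2.2)
  · intro h s hs n d hn hℓ
    rcases s with _ | M
    · exact pDiv_zero d p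
    · by_contra hnd
      exact h M hs ⟨n, n.primeFactors.card, d, ⟨hn, rfl, hℓ⟩, hnd⟩

variable (Dt β ι) in
/-- **`M_∞ = t` from the two halves** (definitions only): global divisibility to depth `t` (J₃ at the frame,
`t ≤ M_∞`) and a level-`(t+1)` certificate (koly's Z₃ᵗ at the frame, `M_∞ ≤ t`) give `Koly.Minf Dt β ι p = t` —
the refined Kolyvagin conjecture's equality ON THE TREE'S OBJECTS. [cite: McCallumLMS1991, §5 Cor. 5.6 (p. 310)]
[cite: BurungaleEtAl2026, Thm. 2 (shape M_∞ = Σ ord_p c_ℓ; nothing used)] -/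
theorem minf_eq_of_globalDivisibility_of_certificateAt (t : ℕ)
    (hJ : ∀ (s : ℕ), s ≤ t → ∀ (n : ℕ) (d : KolyvaginHeegnerData Dt β ι n), Squarefree n →
      (∀ ℓ ∈ n.primeFactors, Zhang2014.IsKolyvaginPrime N W K p ℓ ∧
        s ≤ Zhang2014.kolyvaginIndex W p ℓ) → PDiv d p s)
    (hZ : CertificateAt Dt β ι p t) : Minf Dt β ι p = t :=
  le_antisymm (minf_le_of_certificateAt hZ) ((globalDivisibility_iff_le_minf Dt β ι p t).mp hJ)

end Frame

/-! ### §4 The converse of file 1 §1, any odd `p`: the sharp bound over `K` ⟹ global divisibility -/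

/-- **The Tamagawa-sharp bound over `K` forces global divisibility to depth `t` (McCallum's currency, any odd
`p`).** For `W/ℚ` globally minimal without CM, `K` imaginary quadratic Heegner for `N_E` with `d_K ∉ {−3,−4}`,
`p` odd with `ρ̄_{E,p^m}` onto for all `m`, a frame `(Dt, β, ι)` with conductor-`1` datum `d₁` and `P ∈ E(K)`
under `P_1 = y_K`, `P` of infinite order, `p^{M₀} ∥ P` in `E(K)`, `Ш(E/K)[p^∞]` finite: IF
`ord_p #Ш(E/K)[p^∞] + 2t ≤ 2M₀` (`hbound`) THEN every derived point `P_n` with `n ∈ S_r(s)`, `s ≤ t`, is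
`p^s`-divisible in `E(K[n])`. Proof: a non-divisible `P_n` at depth `s = M + 1 ≤ t` is a level-`(M+1)`
certificate, so McCallum's Cor. 5.6 in certificate form (`hMcL`, via
`two_mul_sub_le_padicValNat_card_sha_primary_of_certificate`) gives `2(M₀ − M) ≤ ord_p #Ш[p^∞] ≤ 2M₀ − 2t`,
impossible for `M < t` (and for `M ≥ M₀` the bound itself gives `t ≤ M₀ ≤ M`). CONDITIONAL on `hMcL`.
[cite: McCallumLMS1991, §5 Cor. 5.6 (p. 310) and the definition of M_r (p. 303)] -/
theorem globalDivisibility_of_card_sha_primary_add_le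
    (hMcL : McCallum1991_pow_dvd_card_sha_primary_of_certificate)
    (W : WeierstrassCurve ℚ) [W.IsElliptic] [W.IsGloballyMinimal] [NeZero (W.conductorNorm ℤ)]
    (hCM : ¬ W.HasCM) (K : Type) [Field K] [NumberField K] (hK : IsImaginaryQuadratic K)
    (h3 : NumberField.discr K ≠ -3) (h4 : NumberField.discr K ≠ -4)
    (hHN : SatisfiesHeegnerHypothesis (W.conductorNorm ℤ) K)
    (p : ℕ) [Fact p.Prime] (hp : p ≠ 2) (hsurj : ∀ m : ℕ, W.HasSurjectiveModNGaloisRep (p ^ m : ℕ))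
    (Dt : ModularParametrizationData W (W.conductorNorm ℤ)) (β : ℤ) (ι : K →+* ℂ)
    (d₁ : KolyvaginHeegnerData Dt β ι 1) (P : (W.baseChange K).toAffine.Point)
    (hPd : d₁.toGeomPoints d₁.derivedPoint = toGeomPoints (W.baseChange K) P)
    (hPinf : ¬ IsOfFinAddOrder P) {M₀ : ℕ}
    (hdiv : ∃ Q : (W.baseChange K).toAffine.Point, ((p ^ M₀ : ℕ) : ℤ) • Q = P)
    (hndiv : ¬ ∃ Q : (W.baseChange K).toAffine.Point, ((p ^ (M₀ + 1) : ℕ) : ℤ) • Q = P)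
    [Finite (AddCommGroup.primaryComponent (W.baseChange K).sha p)] {t : ℕ}
    (hbound : padicValNat p (Nat.card (AddCommGroup.primaryComponent (W.baseChange K).sha p)) + 2 * t ≤
      2 * M₀) :
    ∀ (s : ℕ), s ≤ t → ∀ (n : ℕ) (d : KolyvaginHeegnerData Dt β ι n), Squarefree n →
      (∀ ℓ ∈ n.primeFactors, Zhang2014.IsKolyvaginPrime (W.conductorNorm ℤ) W K p ℓ ∧
        s ≤ Zhang2014.kolyvaginIndex W p ℓ) → PDiv d p s := by
  intro s hs n d hn hℓ
  rcases s with _ | M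
  · exact pDiv_zero d p
  · by_contra hnd
    have hle := two_mul_sub_le_padicValNat_card_sha_primary_of_certificate hMcL W hCM K hK h3 h4 hHN p hp
      hsurj Dt β ι d₁ P hPd hPinf hdiv hndiv d hn hℓ hnd
    omega

/-! ### §5 At `p = 3`, in the index currency of files 1–4: J₃ at the frame ⟺ the sharp bound over `K` -/

/-- **The sharp bound over `K` ⟹ J₃ at the frame (`p = 3`; converse of file 1's
`shaIndexBound_sharp_three_of_globalDivisibility`).** Same frame data as there: `W/ℚ` globally minimal,
multiplicative at `3` with `ρ̄_{E,3}` onto (tower surjectivity by the Tate line, no CM), `K` imaginary quadratic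
Heegner with `d_K ∉ {−3,−4}`, conductor-`1` datum `d₁`, `P = y_K ∈ E(K)` of infinite order, `E(K)` of rank one
without `3`-torsion, `Ш(E/K)` finite. IF `ord₃ #Ш(E/K) + 2t ≤ 2·ord₃[E(K):ℤP]` THEN every derived point `P_n`,
`n ∈ S_r(s)`, `s ≤ t`, on the frame is `3^s`-divisible. Bridges as in file 1 (`3^{M₀} ∥ P` by Mordell–Weil,
`ord₃[E(K):ℤP] = M₀`, `ord₃ #Ш = ord₃ #Ш[3^∞]`), then §4. CONDITIONAL on `hMcL`.
[cite: McCallumLMS1991, §5 Cor. 5.6 (p. 310) and Lemma 5.1 (p. 303)] [cite: Wuthrich2014, Lemma 20 (tower surjectivity at a multiplicative 3)] -/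
theorem globalDivisibility_three_of_shaIndexBound_sharp
    (hMcL : McCallum1991_pow_dvd_card_sha_primary_of_certificate)
    (W : WeierstrassCurve ℚ) [W.IsElliptic] [W.IsGloballyMinimal] [NeZero (W.conductorNorm ℤ)]
    (K : Type) [Field K] [NumberField K]
    (hmult : W.HasMultiplicativeReductionAtPrime 3) (hρ : Surj W 3)
    (hK : IsImaginaryQuadratic K) (h3 : NumberField.discr K ≠ -3) (h4 : NumberField.discr K ≠ -4)
    (hHN : SatisfiesHeegnerHypothesis (W.conductorNorm ℤ) K)
    (Dt : ModularParametrizationData W (W.conductorNorm ℤ)) (β : ℤ) (ι : K →+* ℂ)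
    (d₁ : KolyvaginHeegnerData Dt β ι 1) (P : (W.baseChange K).toAffine.Point)
    (hPd : d₁.toGeomPoints d₁.derivedPoint = toGeomPoints (W.baseChange K) P)
    (hPinf : ¬ IsOfFinAddOrder P)
    (hrank : (W.baseChange K).mordellWeilRank = 1)
    (hiv : ∀ x : (W.baseChange K).toAffine.Point, 3 • x = 0 → x = 0)
    [Finite (W.baseChange K).sha] {t : ℕ}
    (hbound : padicValNat 3 (Nat.card (W.baseChange K).sha) + 2 * t ≤
      2 * padicValNat 3 (AddSubgroup.zmultiples P).index) :
    ∀ (s : ℕ), s ≤ t → ∀ (n : ℕ) (d : KolyvaginHeegnerData Dt β ι n), Squarefree n →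
      (∀ ℓ ∈ n.primeFactors, Zhang2014.IsKolyvaginPrime (W.conductorNorm ℤ) W K 3 ℓ ∧
        s ≤ Zhang2014.kolyvaginIndex W 3 ℓ) → PDiv d 3 s := by
  haveI : Fact (Nat.Prime 3) := ⟨Nat.prime_three⟩
  -- tower surjectivity at a multiplicative 3 (Tate line) and no CM
  have hsurj : ∀ m : ℕ, W.HasSurjectiveModNGaloisRep (3 ^ m : ℕ) :=
    Rank1Residual.surjective_pow_three_of_mult_of_tateLine W hmult hρ
  have hCM : ¬ W.HasCM := not_hasCM_of_hasMultiplicativeReductionAtPrime' W hmult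
  -- the exponent 3^{M₀} ∥ P (Mordell–Weil)
  haveI : Module.Finite ℤ (W.baseChange K).toAffine.Point := (W.baseChange K).module_finite_point_holds
  obtain ⟨M₀, x₀, hx₀, hmax⟩ := exists_pow_smul_eq_and_forall_ne hPinf (p := 3) (by norm_num)
  have hdiv : ∃ Q : (W.baseChange K).toAffine.Point, ((3 ^ M₀ : ℕ) : ℤ) • Q = P :=
    ⟨x₀, by rw [natCast_zsmul]; exact hx₀⟩
  have hndiv : ¬ ∃ Q : (W.baseChange K).toAffine.Point, ((3 ^ (M₀ + 1) : ℕ) : ℤ) • Q = P := by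
    rintro ⟨Q, hQ⟩
    exact hmax Q (by rw [← natCast_zsmul]; exact hQ)
  -- `ord₃ #Ш = ord₃ #Ш[3^∞]` and `ord₃ [E(K):ℤP] = M₀`
  have hsha : padicValNat 3 (Nat.card (AddCommGroup.primaryComponent (W.baseChange K).sha 3)) =
      padicValNat 3 (Nat.card (W.baseChange K).sha) :=
    padicValNat_card_addPrimaryComponent (A := (W.baseChange K).sha) 3
  haveI : Finite (AddCommGroup.torsion (W.baseChange K).toAffine.Point) :=
    WeierstrassCurve.finite_torsion_point (W := W.baseChange K)
  obtain ⟨c, Q, hcQ, hcker⟩ := RankOne.exists_coord_of_mordellWeilRank_eq_one (W.baseChange K) hrank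
  have hidx : padicValNat 3 (AddSubgroup.zmultiples P).index = M₀ :=
    padicValNat_index_zmultiples_eq_of_divisibility c Q hcQ hcker hiv P hdiv hndiv
  refine globalDivisibility_of_card_sha_primary_add_le hMcL W hCM K hK h3 h4 hHN 3 (by norm_num) hsurj Dt β ι
    d₁ P hPd hPinf hdiv hndiv ?_
  rw [hsha, ← hidx]
  exact hbound

/-- **J₃ at the frame ⟺ the Tamagawa-sharp Kolyvagin bound over `K` at the frame (`p = 3`).** On the frame data
of files 1–4 (docstring of `globalDivisibility_three_of_shaIndexBound_sharp`): global `3^s`-divisibility of the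
derived Heegner points to depth `t` ⟺ `ord₃ #Ш(E/K) + 2t ≤ 2·ord₃[E(K):ℤP]`. (⇒) is file 1's
`shaIndexBound_sharp_three_of_globalDivisibility` (McCallum upper form `hMcU`, p418283); (⇐) is
`globalDivisibility_three_of_shaIndexBound_sharp` (certificate form `hMcL`). With `t = ord₃ ∏ c_ℓ(E)` the right
side is the `K`-level content of item 19109's clauses (what `missingUpperBoundAt_of_sharpIndexBound_of_le`
consumes), so the registered stub J₃ʳ ∕ J₃⁰ AT A FRAME is exactly as strong as that content: the reduction of
files 1–2 lost nothing over `K`. CONDITIONAL on `hMcU`, `hMcL` (the two one-sided readings of one printed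
equality). [cite: McCallumLMS1991, §5 Cor. 5.6 (p. 310)] [cite: MatarNekovar2019, Thm. 0.7 and §0.11 (the structure theorem for ρ̄ irreducible, p ≠ 2, no hypothesis at p)] -/
theorem globalDivisibility_three_iff_shaIndexBound_sharp
    (hMcU : McCallum1991_padicValNat_card_sha_primary_add_le_of_globalDivisibility)
    (hMcL : McCallum1991_pow_dvd_card_sha_primary_of_certificate)
    (W : WeierstrassCurve ℚ) [W.IsElliptic] [W.IsGloballyMinimal] [NeZero (W.conductorNorm ℤ)]
    (K : Type) [Field K] [NumberField K]
    (hmult : W.HasMultiplicativeReductionAtPrime 3) (hρ : Surj W 3)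
    (hK : IsImaginaryQuadratic K) (h3 : NumberField.discr K ≠ -3) (h4 : NumberField.discr K ≠ -4)
    (hHN : SatisfiesHeegnerHypothesis (W.conductorNorm ℤ) K)
    (Dt : ModularParametrizationData W (W.conductorNorm ℤ)) (β : ℤ) (ι : K →+* ℂ)
    (d₁ : KolyvaginHeegnerData Dt β ι 1) (P : (W.baseChange K).toAffine.Point)
    (hPd : d₁.toGeomPoints d₁.derivedPoint = toGeomPoints (W.baseChange K) P)
    (hPinf : ¬ IsOfFinAddOrder P)
    (hrank : (W.baseChange K).mordellWeilRank = 1)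
    (hiv : ∀ x : (W.baseChange K).toAffine.Point, 3 • x = 0 → x = 0)
    [Finite (W.baseChange K).sha] (t : ℕ) :
    (∀ (s : ℕ), s ≤ t → ∀ (n : ℕ) (d : KolyvaginHeegnerData Dt β ι n), Squarefree n →
      (∀ ℓ ∈ n.primeFactors, Zhang2014.IsKolyvaginPrime (W.conductorNorm ℤ) W K 3 ℓ ∧
        s ≤ Zhang2014.kolyvaginIndex W 3 ℓ) → PDiv d 3 s) ↔
    padicValNat 3 (Nat.card (W.baseChange K).sha) + 2 * t ≤
      2 * padicValNat 3 (AddSubgroup.zmultiples P).index :=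
  ⟨fun h ↦ shaIndexBound_sharp_three_of_globalDivisibility hMcU W K hmult hρ hK h3 h4 hHN Dt β ι d₁ P hPd
      hPinf hrank hiv h,
    fun h ↦ globalDivisibility_three_of_shaIndexBound_sharp hMcL W K hmult hρ hK h3 h4 hHN Dt β ι d₁ P hPd
      hPinf hrank hiv h⟩

/-- **`t ≤ M_∞` at the frame ⟺ the sharp bound over `K` (`p = 3`)** — §2 composed with
`globalDivisibility_three_iff_shaIndexBound_sharp`: McCallum's `M_∞` ON THE TREE'S OBJECTS is `≥ t` iff
`ord₃ #Ш(E/K) + 2t ≤ 2·ord₃[E(K):ℤP]`. CONDITIONAL on `hMcU`, `hMcL`.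
[cite: McCallumLMS1991, §5 Cor. 5.6 (p. 310) ("ord_p|Ш(E/K)| = 2(M_0 − m)", read as two inequalities)] -/
theorem le_minf_three_iff_shaIndexBound_sharp
    (hMcU : McCallum1991_padicValNat_card_sha_primary_add_le_of_globalDivisibility)
    (hMcL : McCallum1991_pow_dvd_card_sha_primary_of_certificate)
    (W : WeierstrassCurve ℚ) [W.IsElliptic] [W.IsGloballyMinimal] [NeZero (W.conductorNorm ℤ)]
    (K : Type) [Field K] [NumberField K]
    (hmult : W.HasMultiplicativeReductionAtPrime 3) (hρ : Surj W 3)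
    (hK : IsImaginaryQuadratic K) (h3 : NumberField.discr K ≠ -3) (h4 : NumberField.discr K ≠ -4)
    (hHN : SatisfiesHeegnerHypothesis (W.conductorNorm ℤ) K)
    (Dt : ModularParametrizationData W (W.conductorNorm ℤ)) (β : ℤ) (ι : K →+* ℂ)
    (d₁ : KolyvaginHeegnerData Dt β ι 1) (P : (W.baseChange K).toAffine.Point)
    (hPd : d₁.toGeomPoints d₁.derivedPoint = toGeomPoints (W.baseChange K) P)
    (hPinf : ¬ IsOfFinAddOrder P)
    (hrank : (W.baseChange K).mordellWeilRank = 1)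
    (hiv : ∀ x : (W.baseChange K).toAffine.Point, 3 • x = 0 → x = 0)
    [Finite (W.baseChange K).sha] (t : ℕ) :
    (t : ℕ∞) ≤ Minf Dt β ι 3 ↔
    padicValNat 3 (Nat.card (W.baseChange K).sha) + 2 * t ≤
      2 * padicValNat 3 (AddSubgroup.zmultiples P).index :=
  (globalDivisibility_iff_le_minf Dt β ι 3 t).symm.trans
    (globalDivisibility_three_iff_shaIndexBound_sharp hMcU hMcL W K hmult hρ hK h3 h4 hHN Dt β ι d₁ P hPd hPinf
      hrank hiv t)

/-! ### §6 The sharp EQUALITY over `K` pins `M_∞ = t` (converse of file 4 §8 at the `K`-level) -/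

/-- **A level-`(t+1)` certificate from the sharp EQUALITY over `K`** (`p = 3`): on the frame data above, if
`ord₃ #Ш(E/K) + 2t = 2·ord₃[E(K):ℤP]` (the `BSD₃(E/K)` equality at the frame, via Gross–Zagier) then some
derived point `P_n`, `n ∈ S_r(t+1)`, on the frame is NOT `3^{t+1}`-divisible — `Koly.CertificateAt Dt β ι 3 t`,
koly's Z₃ᵗ AT THIS FRAME (`M_∞ ≤ t`). Proof: if no such certificate existed, divisibility would hold to
depth `t + 1` (depths `≤ t` from the equality's `≤`-half via `hMcL`, §5; depth `t + 1` by the assumption, §3),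
and McCallum's upper form `hMcU` would yield `ord₃ #Ш + 2(t+1) ≤ 2·ord₃[E(K):ℤP]`, contradicting the
equality. CONDITIONAL on `hMcU`, `hMcL`. [cite: McCallumLMS1991, §5 Cor. 5.6 (p. 310)] -/
theorem certificateAt_three_of_shaIndexBound_eq
    (hMcU : McCallum1991_padicValNat_card_sha_primary_add_le_of_globalDivisibility)
    (hMcL : McCallum1991_pow_dvd_card_sha_primary_of_certificate)
    (W : WeierstrassCurve ℚ) [W.IsElliptic] [W.IsGloballyMinimal] [NeZero (W.conductorNorm ℤ)]
    (K : Type) [Field K] [NumberField K]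
    (hmult : W.HasMultiplicativeReductionAtPrime 3) (hρ : Surj W 3)
    (hK : IsImaginaryQuadratic K) (h3 : NumberField.discr K ≠ -3) (h4 : NumberField.discr K ≠ -4)
    (hHN : SatisfiesHeegnerHypothesis (W.conductorNorm ℤ) K)
    (Dt : ModularParametrizationData W (W.conductorNorm ℤ)) (β : ℤ) (ι : K →+* ℂ)
    (d₁ : KolyvaginHeegnerData Dt β ι 1) (P : (W.baseChange K).toAffine.Point)
    (hPd : d₁.toGeomPoints d₁.derivedPoint = toGeomPoints (W.baseChange K) P)
    (hPinf : ¬ IsOfFinAddOrder P)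
    (hrank : (W.baseChange K).mordellWeilRank = 1)
    (hiv : ∀ x : (W.baseChange K).toAffine.Point, 3 • x = 0 → x = 0)
    [Finite (W.baseChange K).sha] {t : ℕ}
    (heq : padicValNat 3 (Nat.card (W.baseChange K).sha) + 2 * t =
      2 * padicValNat 3 (AddSubgroup.zmultiples P).index) :
    CertificateAt Dt β ι 3 t := by
  -- divisibility to depth t from the `≤`-half of the equality
  have hJ := globalDivisibility_three_of_shaIndexBound_sharp hMcL W K hmult hρ hK h3 h4 hHN Dt β ι d₁ P hPd
    hPinf hrank hiv heq.le
  by_contra hno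
  -- no certificate of level t + 1: divisibility also at depth t + 1, hence to depth t + 1
  have hJ' : ∀ (s : ℕ), s ≤ t + 1 → ∀ (n : ℕ) (d : KolyvaginHeegnerData Dt β ι n), Squarefree n →
      (∀ ℓ ∈ n.primeFactors, Zhang2014.IsKolyvaginPrime (W.conductorNorm ℤ) W K 3 ℓ ∧
        s ≤ Zhang2014.kolyvaginIndex W 3 ℓ) → PDiv d 3 s := by
    rw [globalDivisibility_iff_forall_not_certificateAt Dt β ι 3 (t + 1)]
    intro M hM
    rcases Nat.lt_succ_iff_lt_or_eq.mp hM with hlt | rfl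
    · exact (globalDivisibility_iff_forall_not_certificateAt Dt β ι 3 t).mp hJ M hlt
    · exact hno
  have hle := shaIndexBound_sharp_three_of_globalDivisibility hMcU W K hmult hρ hK h3 h4 hHN Dt β ι d₁ P hPd
    hPinf hrank hiv hJ'
  omega

/-- **The sharp EQUALITY over `K` pins `M_∞ = t` on the tree's objects** (`p = 3`): on the frame data above,
`ord₃ #Ш(E/K) + 2t = 2·ord₃[E(K):ℤP]` ⟹ `Koly.Minf Dt β ι 3 = t`. With file 4 §8 (certificate ∧ divisibility ⟹
`BSDp W 3`) this is the frame-level dictionary «refined Kolyvagin conjecture `M_∞ = t` at `3 ∥ N`» ⟷ «sharp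
`BSD₃(E/K)`». CONDITIONAL on `hMcU`, `hMcL`. [cite: McCallumLMS1991, §5 Cor. 5.6 (p. 310)]
[cite: Jetchev2008, (1) p. 812 and Conj. 1.3 (the refined conjecture; nothing used)] -/
theorem minf_three_eq_of_shaIndexBound_eq
    (hMcU : McCallum1991_padicValNat_card_sha_primary_add_le_of_globalDivisibility)
    (hMcL : McCallum1991_pow_dvd_card_sha_primary_of_certificate)
    (W : WeierstrassCurve ℚ) [W.IsElliptic] [W.IsGloballyMinimal] [NeZero (W.conductorNorm ℤ)]
    (K : Type) [Field K] [NumberField K]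
    (hmult : W.HasMultiplicativeReductionAtPrime 3) (hρ : Surj W 3)
    (hK : IsImaginaryQuadratic K) (h3 : NumberField.discr K ≠ -3) (h4 : NumberField.discr K ≠ -4)
    (hHN : SatisfiesHeegnerHypothesis (W.conductorNorm ℤ) K)
    (Dt : ModularParametrizationData W (W.conductorNorm ℤ)) (β : ℤ) (ι : K →+* ℂ)
    (d₁ : KolyvaginHeegnerData Dt β ι 1) (P : (W.baseChange K).toAffine.Point)
    (hPd : d₁.toGeomPoints d₁.derivedPoint = toGeomPoints (W.baseChange K) P)
    (hPinf : ¬ IsOfFinAddOrder P)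
    (hrank : (W.baseChange K).mordellWeilRank = 1)
    (hiv : ∀ x : (W.baseChange K).toAffine.Point, 3 • x = 0 → x = 0)
    [Finite (W.baseChange K).sha] {t : ℕ}
    (heq : padicValNat 3 (Nat.card (W.baseChange K).sha) + 2 * t =
      2 * padicValNat 3 (AddSubgroup.zmultiples P).index) :
    Minf Dt β ι 3 = t :=
  minf_eq_of_globalDivisibility_of_certificateAt Dt β ι 3 t
    (globalDivisibility_three_of_shaIndexBound_sharp hMcL W K hmult hρ hK h3 h4 hHN Dt β ι d₁ P hPd hPinf
      hrank hiv heq.le)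
    (certificateAt_three_of_shaIndexBound_eq hMcU hMcL W K hmult hρ hK h3 h4 hHN Dt β ι d₁ P hPd hPinf hrank
      hiv heq)

end Summit.BirchSwinnertonDyer.Rank1Residual.X11b.Three.Koly

end
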